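import Summits.QuantumFields.YangMills.Theorems.BalabanUVNodesN15CovariantAveragingPropagatorRows
import Summits.QuantumFields.YangMills.Theorems.BalabanUVNodesN15CovariantAveragingPropagatorDefectRow
import Summits.QuantumFields.YangMills.Theorems.BalabanUVNodesN15SmallFieldSiteLayerAnyPropagator
import Summits.QuantumFields.YangMills.Theorems.BalabanUVNodesN15TwoSpacingGluingCurvedKnitCovariantAveragingNode
import HarnessLib

/-!
# N15 = NE2 — PROGRAMME 𝟙P «ONE PROPAGATOR», part (𝟙P-e″): ★★★ dag-n15-c's PROPAGATOR FAMILY `X_q` (covariant averaging summand live) MEETS THE THREE DISPLAYED ROWS UNDER BAŁABAN's CLASS (3.35)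
# (dag-n15-a g32, FILE (𝟙P-e″); node N15 = NE2; `--kind proof --supports stmt-QuantumFields-27366 --as helper`, count-neutral; one theorem, 0 def; imports (𝟙P-e), (𝟙P-e‴), (𝟙P-c), n15-c 189b)

WHY ∕ HOW.  (𝟙P-c) `ne2PlusSite_foSiteAny` ∕ (𝟙P-d) `ne2PlusUnit_foCovAnyLam` display the inner propagator family by the hypothesis `hX` (increment size `K_X·(c₃₅L^mα₀)` at both spacings, two-grid
defect `K_X·(L^k)^{−1∕16}`, under `Reg335 c₃₅ α₀ A′`, cubes `L^m ≥ w_X`, window `c₃₅L^mα₀ ≤ s_X`).  This file proves `hX` for dag-n15-c's `X_q` (189a `sfqEntry0` l.52, as a family over the node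
index and the potential) from (𝟙P-e) `exists_hasMaj_sfq_sub_tensorId_gOp` and (𝟙P-e‴) `exists_hasMaj_idef_sfq_sub_tensorId_gOp`, discharging 191∕188's regime from the class by n15-c∕189b's
threshold template VERBATIM: `sfInstance_reg335_iff` (Frobenius letters of the class) + 189b `l2_opNorm_le_frobenius_norm` (⇒ operator-norm letters), the window `W·r_A ≤ 1`, the transporter
sizes `K_c, K_f ≤ 4(d+2)Λ·r_A ≤ 1` (189b `pow_sub_one_le_exp_sub_one` + `exp_sub_one_le_two_mul`), the scale conditions `σr_AJJ + R₁(K_c + K_f) ≤ R₀`, `R₁(K_c + K_f) ≤ θ₀`, and 188's bracket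
`≤ (1 + C₁)(L^k)^{−1∕16}` ((𝟙P-a) `inv_le_rpow_neg_sixteenth`).  `K_X = max(K_b(κ_e + 8(d+2)Λ), K_c(1 + C₁))`, `ρ_X = min(δ_b, δ_c)`, `w_X = max(w_b, w_c)`.

WHAT.  ★★★ `rows_sfq`: (𝟙P-c)'s `hX` VERBATIM for `Xc := X_q`, `Xf := X′_q` — so (𝟙P-f) instantiates the generic site ∕ unit layers at `X_q` by `exact`: ONE propagator in all three layers.

HONEST FRAMING ∕ LIMITS.  Threshold bookkeeping over (𝟙P-e)∕(𝟙P-e‴); MODEL carriers of dag-n15-c (two-spacing glued doubled torus `sfInstance`, global small-field gauge `u ≡ 1`, `Q(U)` = main term of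
[5] (125), Landau summand FLAT, `Reg336` idle, King-block-mean pairing, `L ≥ 7`, crude constants); NOT [B9] Thms 3.1∕3.2∕3.15 AS PRINTED; no layer of NE2 here; N15 stays DISCHARGED OF RECORD 8∕28
AS CONSUMED (U-blind v7 pin, p687738) — nothing re-claimed, no count moved; K3⁸ OPEN; finite 𝕋⁴ per index — NOT ℝ⁴ ∕ OS ∕ mass gap ∕ Clay.  `set_option maxHeartbeats 800000 in` ×1 (189b's budget).
No `sorry`, `def`, `instance`, `notation`; standard axioms.
[cite: Balaban1985BackgroundPropagators, (3.35) p.396, Thm 3.1 p.397 («for U satisfying (3.35), Mα₀ ≤ a₀, M ≥ M₁»), (3.62)–(3.65) pp.402–403, (3.26) p.395; Balaban1985Averaging, (124)–(126) p.36; King1986, p.664 (the pairing)]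
-/

noncomputable section

open scoped BigOperators Matrix

namespace Summit.QuantumFields.YangMills.BalabanUVNodes.N15.SiteLayerSf

open Literature.MathematicalPhysics.QuantumFieldTheory.Balaban1983to89
open Literature.MathematicalPhysics.QuantumFieldTheory.Balaban1983to89.B11SectG (BlockNorm HasMaj)
open Literature.MathematicalPhysics.QuantumFieldTheory.Balaban1983to89.B5Prop11Plancherel (Tor fine)
open Literature.MathematicalPhysics.QuantumFieldTheory.Balaban1983to89.B6UnitTorusCarrier (unitTorusGeo unitTorusGeo_dist_nonneg)
open Literature.MathematicalPhysics.QuantumFieldTheory.Balaban1983to89.T4EtaRateDefect (idef)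
open Literature.MathematicalPhysics.QuantumFieldTheory.Balaban1983to89.T4EtaRateCoeffDefect (pull)
open Literature.MathematicalPhysics.QuantumFieldTheory.King1986.Torus (blockOf tdistT)
open Literature.Barriers.QuantumFields (traceForm)
open Summit.QuantumFields.YangMills.BalabanUVNodes.N15.SiteLayer (hasMaj_exp_mono)
open Summit.QuantumFields.YangMills.BalabanUVNodes.N15.BackgroundLayer (gavgM)
open Summit.QuantumFields.YangMills.BalabanUVNodes.N15.VectorPiece (bshiftEquiv kingPrV tensorId)
open Summit.QuantumFields.YangMills.BalabanUVNodes.N15.MatrixSpecies (basisConst basisConst_nonneg liftBlk liftMap)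
open Summit.QuantumFields.YangMills.BalabanUVNodes.N15.TwoGrid (gOp)
open Summit.QuantumFields.YangMills.BalabanUVNodes.N15.Gluing (SfIdx sfGeo sfInstance sfInstance_reg335_iff CvX CvX' cvM cvBlk CvNorm cvNL cvNL' cvGlued cvGlued' cvNVq cvNVq'
  l2_opNorm_le_frobenius_norm pow_sub_one_le_exp_sub_one)
open Summit.QuantumFields.YangMills.BalabanUVNodes.N15.GluedZeroField (exists_hasMaj_sfq_sub_tensorId_gOp exists_hasMaj_idef_sfq_sub_tensorId_gOp inv_le_rpow_neg_sixteenth)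
open Literature.NumberTheory.Sieve.SquarefreeSums (exp_sub_one_le_two_mul)

variable {d : ℕ} {L : ℕ} [NeZero L] {mm ι : Type} [Fintype mm] [DecidableEq mm] [Fintype ι] [DecidableEq ι] {a : ℝ} {e : Matrix mm mm ℂ ≃L[ℝ] (ι → ℝ)}

open scoped Matrix.Norms.L2Operator

set_option maxHeartbeats 800000 in
/-- ★★★ **dag-n15-c's `X_q` MEETS THE THREE DISPLAYED ROWS UNDER THE CLASS** (`L ≥ 7` odd, `a, c₃₅ > 0`, trace-form coordinates `e`, `ι`, `mm` nonempty): there are `ρ_X > 0`, `K_X ≥ 0`, a cube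
floor `w_X` and a window `s_X > 0` such that under `Reg335 c₃₅ α₀ A′` with `L^m ≥ w_X`, `c₃₅L^mα₀ ≤ s_X` the increments of `(X′_q(A′), X_q(A′))` over the flat pair carry the size `K_X·(c₃₅L^mα₀)·e^{−ρ_X d}`
at both spacings and the two-grid defect `K_X·(L^k)^{−1∕16}·e^{−ρ_X d}` — (𝟙P-c)'s hypothesis `hX` at `Xc := X_q`, `Xf := X′_q`. [cite: Balaban1985BackgroundPropagators, (3.35) p.396, (3.62)–(3.65) pp.402–403, Thm 3.1 (3.42) p.397 (shapes), (3.26) p.395; Balaban1985Averaging, (124)–(126) p.36] -/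
theorem rows_sfq [Nonempty ι] [Nonempty mm] (hL : Odd L ∧ 1 < L) (hL7 : 7 ≤ L) (ha : 0 < a) {c35 : ℝ} (hc35 : 0 < c35) (he : ∀ A B : Matrix mm mm ℂ, traceForm A B = e A ⬝ᵥ e B) :
    ∃ ρX KX wX sX : ℝ, 0 < ρX ∧ 0 ≤ KX ∧ 0 < sX ∧
      ∀ (i : SfIdx d L) (α₀ : ℝ) (A' : Fin (d + 1) → CvX' d L i.m i.kk i.r hL → Matrix mm mm ℂ), 0 < α₀ → wX ≤ ((L ^ i.m : ℕ) : ℝ) → c35 * (L : ℝ) ^ i.m * α₀ ≤ sX →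
        (sfInstance d mm ι hL i).Bf.Reg335 c35 α₀ A' →
        HasMaj (CvNorm d L i.m i.kk hL ι) (CvNorm d L i.m i.kk hL ι) (cvGlued d L i.m i.kk hL a ((((L ^ i.kk : ℕ) : ℝ))⁻¹) ι e (fun _ _ => (1 : Matrix mm mm ℂ)) (fun μ x => NormedSpace.exp (((((L ^ i.kk : ℕ) : ℝ))⁻¹) • gavgM (Matrix mm mm ℂ) (Fin (d + 1)) (kingPrV L i.kk i.r (cvM d L i.m i.kk hL)) A' μ x)) (cvNL d L i.m i.kk hL a ι - (cvNVq d L i.m i.kk hL a ι e (fun μ x => NormedSpace.exp (((((L ^ i.kk : ℕ) : ℝ))⁻¹) • gavgM (Matrix mm mm ℂ) (Fin (d + 1)) (kingPrV L i.kk i.r (cvM d L i.m i.kk hL)) A' μ x)))) (fun _ => (cvNVq d L i.m i.kk hL a ι e (fun μ x => NormedSpace.exp (((((L ^ i.kk : ℕ) : ℝ))⁻¹) • gavgM (Matrix mm mm ℂ) (Fin (d + 1)) (kingPrV L i.kk i.r (cvM d L i.m i.kk hL)) A' μ x)))) - tensorId ι (gOp (cvM d L i.m i.kk hL) (L ^ i.kk)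 a))
          (fun y y' => KX * (c35 * (L : ℝ) ^ i.m * α₀) * Real.exp (-(ρX * (unitTorusGeo L i.kk (cvM d L i.m i.kk hL)).dist y y'))) ∧
        HasMaj (BlockNorm.ofBlocks (unitTorusGeo L i.kk (cvM d L i.m i.kk hL)) (liftBlk (fun b : CvX' d L i.m i.kk i.r hL => blockOf (L ^ i.r * L ^ i.kk) (cvM d L i.m i.kk hL) b.1) ι)) (BlockNorm.ofBlocks (unitTorusGeo L i.kk (cvM d L i.m i.kk hL)) (liftBlk (fun b : CvX' d L i.m i.kk i.r hL => blockOf (L ^ i.r * L ^ i.kk) (cvM d L i.m i.kk hL) b.1) ι)) (cvGlued' d L i.m i.kk i.r hL a ((((L ^ i.r * L ^ i.kk : ℕ) : ℝ))⁻¹) ι e (fun _ _ => (1 : Matrix mm mm ℂ)) (fun μ x' => NormedSpace.exp (((((L ^ i.r * L ^ i.kk : ℕ) : ℝ))⁻¹) • A' μ x')) (cvNL' d L i.m i.kk i.r hL a ι - (cvNVq' d L i.m i.kk i.r hL a ι e (fun μ x' => NormedSpace.exp (((((L ^ i.r * L ^ i.kk : ℕ) : ℝ))⁻¹) • A' μ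 x')))) (fun _ => (cvNVq' d L i.m i.kk i.r hL a ι e (fun μ x' => NormedSpace.exp (((((L ^ i.r * L ^ i.kk : ℕ) : ℝ))⁻¹) • A' μ x')))) - tensorId ι (gOp (cvM d L i.m i.kk hL) (L ^ i.r * L ^ i.kk) a))
          (fun y y' => KX * (c35 * (L : ℝ) ^ i.m * α₀) * Real.exp (-(ρX * (unitTorusGeo L i.kk (cvM d L i.m i.kk hL)).dist y y'))) ∧
        HasMaj (CvNorm d L i.m i.kk hL ι) (BlockNorm.ofBlocks (unitTorusGeo L i.kk (cvM d L i.m i.kk hL)) (liftBlk (fun b : CvX' d L i.m i.kk i.r hL => blockOf (L ^ i.r * L ^ i.kk) (cvM d L i.m i.kk hL) b.1) ι))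
          (idef (pull (liftMap (kingPrV L i.kk i.r (cvM d L i.m i.kk hL)) ι)) (pull (liftMap (kingPrV L i.kk i.r (cvM d L i.m i.kk hL)) ι)) (cvGlued' d L i.m i.kk i.r hL a ((((L ^ i.r * L ^ i.kk : ℕ) : ℝ))⁻¹) ι e (fun _ _ => (1 : Matrix mm mm ℂ)) (fun μ x' => NormedSpace.exp (((((L ^ i.r * L ^ i.kk : ℕ) : ℝ))⁻¹) • A' μ x')) (cvNL' d L i.m i.kk i.r hL a ι - (cvNVq' d L i.m i.kk i.r hL a ι e (fun μ x' => NormedSpace.exp (((((L ^ i.r * L ^ i.kk : ℕ) : ℝ))⁻¹) • A' μ x')))) (fun _ => (cvNVq' d L i.m i.kk i.r hL a ι e (fun μ x' => NormedSpace.exp (((((L ^ i.r * L ^ i.kk : ℕ) : ℝ))⁻¹) • A' μ x')))) - tensorId ι (gOp (cvM d L i.m i.kk hL) (L ^ i.r * L ^ i.kk) a)) (cvGlued d L i.m i.kk hL a ((((L ^ i.kk : ℕ) : ℝ))⁻¹) ι e (fun _ _ => (1 : Matrix mm mm ℂ)) (fun μ x => NormedSpace.exp (((((L ^ i.kk : ℕ)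 : ℝ))⁻¹) • gavgM (Matrix mm mm ℂ) (Fin (d + 1)) (kingPrV L i.kk i.r (cvM d L i.m i.kk hL)) A' μ x)) (cvNL d L i.m i.kk hL a ι - (cvNVq d L i.m i.kk hL a ι e (fun μ x => NormedSpace.exp (((((L ^ i.kk : ℕ) : ℝ))⁻¹) • gavgM (Matrix mm mm ℂ) (Fin (d + 1)) (kingPrV L i.kk i.r (cvM d L i.m i.kk hL)) A' μ x)))) (fun _ => (cvNVq d L i.m i.kk hL a ι e (fun μ x => NormedSpace.exp (((((L ^ i.kk : ℕ) : ℝ))⁻¹) • gavgM (Matrix mm mm ℂ) (Fin (d + 1)) (kingPrV L i.kk i.r (cvM d L i.m i.kk hL)) A' μ x)))) - tensorId ι (gOp (cvM d L i.m i.kk hL) (L ^ i.kk) a)))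
          (fun y y' => KX * ((((L ^ i.kk : ℕ) : ℝ)) ^ (-(1 / 16 : ℝ))) * Real.exp (-(ρX * (unitTorusGeo L i.kk (cvM d L i.m i.kk hL)).dist y y'))) := by
  have hLpos : 0 < L := Nat.pos_of_ne_zero (NeZero.ne L)
  have hLr : (0 : ℝ) < (L : ℝ) := Nat.cast_pos.mpr hLpos
  have hL1 : (1 : ℝ) ≤ (L : ℝ) := by exact_mod_cast hLpos
  obtain ⟨δb, wb, Rb, θb, R1b, Kb, hδb, hRb, hθb, hR1b, hKb, Hb⟩ := exists_hasMaj_sfq_sub_tensorId_gOp (d := d) hL hL7 ha ι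
  obtain ⟨δc, wc, Rc, θc, R1c, Kc, hδc, hRc, hθc, hR1c, hKcpos, Hc⟩ := exists_hasMaj_idef_sfq_sub_tensorId_gOp (d := d) hL hL7 ha ι
  -- the constants (189b's)
  have hκ0 : 0 ≤ basisConst e := basisConst_nonneg e
  have hκF := @basisConst_nonneg ι _ (Matrix mm mm ℂ) Matrix.frobeniusNormedAddCommGroup Matrix.frobeniusNormedSpace e
  let σ : ℝ := 14 * Real.exp 1 * (1 + Fintype.card (Fin (d + 1))) * basisConst e * ((1 + Fintype.card (Fin (d + 1))) * (3 + 2 * ((d : ℝ) + 1)))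
  have hσ0 : 0 ≤ σ := by positivity
  let JJ : ℝ := 1 + Fintype.card (Fin (d + 1) ⊕ Fin (d + 1))
  have hJJ0 : 0 ≤ JJ := by positivity
  let W : ℝ := 2 * ((1 + Fintype.card (Fin (d + 1))) * (3 + 2 * ((d : ℝ) + 1)))
  have hW0 : 0 < W := by positivity
  have hW1 : 1 ≤ W := by
    show (1 : ℝ) ≤ 2 * ((1 + Fintype.card (Fin (d + 1))) * (3 + 2 * ((d : ℝ) + 1)))
    have h1 : (1 : ℝ) ≤ 1 + Fintype.card (Fin (d + 1)) := le_add_of_nonneg_right (Nat.cast_nonneg _)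
    have h2 : (1 : ℝ) ≤ 3 + 2 * ((d : ℝ) + 1) := by have := (Nat.cast_nonneg d : (0 : ℝ) ≤ d); linarith
    nlinarith
  let Λ : ℝ := (Fintype.card ι * (@basisConst ι _ (Matrix mm mm ℂ) Matrix.frobeniusNormedAddCommGroup Matrix.frobeniusNormedSpace e * (2 * Real.sqrt (Fintype.card mm)) * Real.sqrt (Fintype.card mm)))
  have hΛ0 : 0 ≤ Λ := by positivity
  let cΦ : ℝ := (3 ^ (d + 1) * (72 * ((d : ℝ) + 1) ^ 2 + 9 * ((d : ℝ) + 1)) + (2 + 2 * Real.exp 1 + 2 * Real.exp 1 ^ 2 * ((d : ℝ) + 1)))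
  have hcΦ0 : 0 ≤ cΦ := by positivity
  let G : ℝ := 8 * ((d : ℝ) + 2) * Λ
  have hG0 : 0 ≤ G := by positivity
  -- the window `s_X` on `r_A = c₃₅L^mα₀`
  let sW : ℝ := 1 / W
  let sK : ℝ := 1 / (4 * ((d : ℝ) + 2) * Λ + 1)
  let sRb : ℝ := Rb / (σ * JJ + R1b * G + 1)
  let sθb : ℝ := θb / (R1b * G + 1)
  let sRc : ℝ := Rc / (σ * JJ + R1c * G + 1)
  let sθc : ℝ := θc / (R1c * G + 1)
  let sX : ℝ := min (min sW sK) (min (min sRb sθb) (min sRc sθc))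
  have hsX : 0 < sX := lt_min (lt_min (by positivity) (by positivity)) (lt_min (lt_min (by positivity) (by positivity)) (lt_min (by positivity) (by positivity)))
  have hsW : sX ≤ sW := (min_le_left _ _).trans (min_le_left _ _)
  have hsK : sX ≤ sK := (min_le_left _ _).trans (min_le_right _ _)
  have hsRb : sX ≤ sRb := ((min_le_right _ _).trans (min_le_left _ _)).trans (min_le_left _ _)
  have hsθb : sX ≤ sθb := ((min_le_right _ _).trans (min_le_left _ _)).trans (min_le_right _ _)
  have hsRc : sX ≤ sRc := ((min_le_right _ _).trans (min_le_right _ _)).trans (min_le_left _ _)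
  have hsθc : sX ≤ sθc := ((min_le_right _ _).trans (min_le_right _ _)).trans (min_le_right _ _)
  let C₁ : ℝ := σ * sX * JJ + 2 * (R1c * (20 + 4 * (Λ * cΦ * sX)))
  have hC₁0 : 0 ≤ C₁ := by positivity
  refine ⟨min δb δc, max (Kb * (basisConst e + G)) (Kc * (1 + C₁)), max wb wc, sX, lt_min hδb hδc, le_max_of_le_left (by positivity), hsX,
    fun i α₀ A' hα₀ hw hrS hA' => ?_⟩
  set M := cvM d L i.m i.kk hL with hMdef
  have hd := fun y y' => unitTorusGeo_dist_nonneg L i.kk M y y'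
  have hwb : wb ≤ ((L ^ i.m : ℕ) : ℝ) := (le_max_left _ _).trans hw
  have hwc : wc ≤ ((L ^ i.m : ℕ) : ℝ) := (le_max_right _ _).trans hw
  have hx1 : (1 : ℝ) ≤ (L : ℝ) ^ i.kk := one_le_pow₀ hL1
  have hxpos : (0 : ℝ) < (L : ℝ) ^ i.kk := pow_pos hLr _
  have hcast : (((L ^ i.kk : ℕ) : ℝ)) = (L : ℝ) ^ i.kk := by push_cast; rfl
  have hkpos : (0 : ℝ) < (((L ^ i.kk : ℕ) : ℝ)) := by rw [hcast]; exact hxpos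
  have hx1' : (1 : ℝ) ≤ (((L ^ i.kk : ℕ) : ℝ)) := by rw [hcast]; exact hx1
  have hθ0 : 0 ≤ (((L ^ i.kk : ℕ) : ℝ)) ^ (-(1 / 16 : ℝ)) := Real.rpow_nonneg hkpos.le _
  have hη0 : 0 ≤ ((((L ^ i.kk : ℕ) : ℝ)))⁻¹ := inv_nonneg.mpr hkpos.le
  have hηθ : ((((L ^ i.kk : ℕ) : ℝ)))⁻¹ ≤ (((L ^ i.kk : ℕ) : ℝ)) ^ (-(1 / 16 : ℝ)) := inv_le_rpow_neg_sixteenth hx1'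
  -- the class at the index: skewness and Frobenius letters ⟹ operator-norm letters
  obtain ⟨hskew, h1F, h2F, h3F⟩ := (sfInstance_reg335_iff d mm ι hL i c35 α₀ A').1 hA'
  have hconv : ((L : ℝ) ^ i.kk)⁻¹ * ((L : ℝ) ^ i.r)⁻¹ = ((((L ^ i.r * L ^ i.kk : ℕ) : ℝ))⁻¹) := by
    push_cast
    rw [mul_inv, mul_comm]
  have hrA0 : 0 ≤ (c35 * (L : ℝ) ^ i.m * α₀) := by positivity
  have h1 : ∀ μ x', ‖A' μ x'‖ ≤ (c35 * (L : ℝ) ^ i.m * α₀) := fun μ x' => (l2_opNorm_le_frobenius_norm _).trans (h1F μ x')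
  have h2' : ∀ μ κ x', ‖A' μ (bshiftEquiv (cvM d L i.m i.kk hL) (L ^ i.r * L ^ i.kk) κ x') - A' μ x'‖ ≤ (c35 * (L : ℝ) ^ i.m * α₀) * ((((L ^ i.r * L ^ i.kk : ℕ) : ℝ))⁻¹) :=
    fun μ κ x' => ((l2_opNorm_le_frobenius_norm _).trans (h2F μ κ x')).trans_eq (by rw [hconv])
  have h3' : ∀ μ κ x', ‖(A' μ (bshiftEquiv (cvM d L i.m i.kk hL) (L ^ i.r * L ^ i.kk) κ x') - A' μ x') -
      (A' μ (bshiftEquiv (cvM d L i.m i.kk hL) (L ^ i.r * L ^ i.kk) κ ((bshiftEquiv (cvM d L i.m i.kk hL) (L ^ i.r * L ^ i.kk) μ).symm x')) -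
        A' μ ((bshiftEquiv (cvM d L i.m i.kk hL) (L ^ i.r * L ^ i.kk) μ).symm x'))‖ ≤ (c35 * (L : ℝ) ^ i.m * α₀) * ((((L ^ i.r * L ^ i.kk : ℕ) : ℝ))⁻¹) * ((((L ^ i.r * L ^ i.kk : ℕ) : ℝ))⁻¹) :=
    fun μ κ x' => ((l2_opNorm_le_frobenius_norm _).trans (h3F μ κ x')).trans_eq (by rw [hconv])
  -- the window `W·r_A ≤ 1`, hence `r_A ≤ 1`
  have hrW : (c35 * (L : ℝ) ^ i.m * α₀) ≤ 1 / W := hrS.trans hsW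
  have hr2 : 2 * ((1 + Fintype.card (Fin (d + 1))) * ((3 + 2 * ((d : ℝ) + 1)) * (c35 * (L : ℝ) ^ i.m * α₀))) ≤ 1 := by
    calc 2 * ((1 + Fintype.card (Fin (d + 1))) * ((3 + 2 * ((d : ℝ) + 1)) * (c35 * (L : ℝ) ^ i.m * α₀))) = W * (c35 * (L : ℝ) ^ i.m * α₀) := by ring
      _ ≤ W * (1 / W) := mul_le_mul_of_nonneg_left hrW hW0.le
      _ = 1 := by field_simp
  have hrA1 : (c35 * (L : ℝ) ^ i.m * α₀) ≤ 1 := hrW.trans ((div_le_one hW0).mpr hW1)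
  -- the transporter sizes `K_c, K_f ≤ 4(d+2)Λ·r_A ≤ 1`
  have hKr : 4 * ((d : ℝ) + 2) * Λ * (c35 * (L : ℝ) ^ i.m * α₀) ≤ 1 := by
    have hden : 0 < 4 * ((d : ℝ) + 2) * Λ + 1 := by positivity
    calc 4 * ((d : ℝ) + 2) * Λ * (c35 * (L : ℝ) ^ i.m * α₀) ≤ 4 * ((d : ℝ) + 2) * Λ * (1 / (4 * ((d : ℝ) + 2) * Λ + 1)) := mul_le_mul_of_nonneg_left (hrS.trans hsK) (by positivity)
      _ = (4 * ((d : ℝ) + 2) * Λ) / (4 * ((d : ℝ) + 2) * Λ + 1) := by ring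
      _ ≤ 1 := (div_le_one hden).mpr (by linarith)
  have hx2 : 0 ≤ 2 * ((d : ℝ) + 2) * Λ * (c35 * (L : ℝ) ^ i.m * α₀) := by positivity
  have hx2' : 2 * ((d : ℝ) + 2) * Λ * (c35 * (L : ℝ) ^ i.m * α₀) ≤ 1 := by linarith
  have hKc : ((1 + Fintype.card ι * (@basisConst ι _ (Matrix mm mm ℂ) Matrix.frobeniusNormedAddCommGroup Matrix.frobeniusNormedSpace e * (2 * Real.sqrt (Fintype.card mm)) * (Real.sqrt (Fintype.card mm) * (2 * ((c35 * (L : ℝ) ^ i.m * α₀) * ((((L ^ i.kk : ℕ) : ℝ))⁻¹)))))) ^ ((d + 2) * L ^ i.kk) - 1) ≤ 4 * ((d : ℝ) + 2) * Λ * (c35 * (L : ℝ) ^ i.m * α₀) := by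
    have hy0 : 0 ≤ Fintype.card ι * (@basisConst ι _ (Matrix mm mm ℂ) Matrix.frobeniusNormedAddCommGroup Matrix.frobeniusNormedSpace e * (2 * Real.sqrt (Fintype.card mm)) * (Real.sqrt (Fintype.card mm) * (2 * ((c35 * (L : ℝ) ^ i.m * α₀) * ((((L ^ i.kk : ℕ) : ℝ))⁻¹))))) := by positivity
    refine (pow_sub_one_le_exp_sub_one hy0 _).trans ?_
    have hexp : Fintype.card ι * (@basisConst ι _ (Matrix mm mm ℂ) Matrix.frobeniusNormedAddCommGroup Matrix.frobeniusNormedSpace e * (2 * Real.sqrt (Fintype.card mm)) * (Real.sqrt (Fintype.card mm) * (2 * ((c35 * (L : ℝ) ^ i.m * α₀) * ((((L ^ i.kk : ℕ) : ℝ))⁻¹))))) * (((d + 2) * L ^ i.kk : ℕ) : ℝ) = 2 * ((d : ℝ) + 2) * Λ * (c35 * (L : ℝ) ^ i.m * α₀) := by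
      have hk0 : (((L ^ i.kk : ℕ) : ℝ)) ≠ 0 := by rw [hcast]; exact hxpos.ne'
      push_cast
      field_simp
      ring
    rw [hexp]
    have h := exp_sub_one_le_two_mul hx2 hx2'
    linarith
  have hKf : ((1 + Fintype.card ι * (@basisConst ι _ (Matrix mm mm ℂ) Matrix.frobeniusNormedAddCommGroup Matrix.frobeniusNormedSpace e * (2 * Real.sqrt (Fintype.card mm)) * (Real.sqrt (Fintype.card mm) * (2 * ((c35 * (L : ℝ) ^ i.m * α₀) * ((((L ^ i.r * L ^ i.kk : ℕ) : ℝ))⁻¹)))))) ^ ((d + 2) * (L ^ i.r * L ^ i.kk)) - 1) ≤ 4 * ((d : ℝ) + 2) * Λ * (c35 * (L : ℝ) ^ i.m * α₀) := by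
    have hy0 : 0 ≤ Fintype.card ι * (@basisConst ι _ (Matrix mm mm ℂ) Matrix.frobeniusNormedAddCommGroup Matrix.frobeniusNormedSpace e * (2 * Real.sqrt (Fintype.card mm)) * (Real.sqrt (Fintype.card mm) * (2 * ((c35 * (L : ℝ) ^ i.m * α₀) * ((((L ^ i.r * L ^ i.kk : ℕ) : ℝ))⁻¹))))) := by positivity
    refine (pow_sub_one_le_exp_sub_one hy0 _).trans ?_
    have hexp : Fintype.card ι * (@basisConst ι _ (Matrix mm mm ℂ) Matrix.frobeniusNormedAddCommGroup Matrix.frobeniusNormedSpace e * (2 * Real.sqrt (Fintype.card mm)) * (Real.sqrt (Fintype.card mm) * (2 * ((c35 * (L : ℝ) ^ i.m * α₀) * ((((L ^ i.r * L ^ i.kk : ℕ) : ℝ))⁻¹))))) * (((d + 2) * (L ^ i.r * L ^ i.kk) : ℕ) : ℝ) = 2 * ((d : ℝ) + 2) * Λ * (c35 * (L : ℝ) ^ i.m * α₀) := by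
      have hk0 : (((L ^ i.r * L ^ i.kk : ℕ) : ℝ)) ≠ 0 := Nat.cast_ne_zero.mpr (Nat.pos_iff_ne_zero.mp (Nat.mul_pos (pow_pos hLpos _) (pow_pos hLpos _)))
      field_simp
      push_cast
      ring
    rw [hexp]
    have h := exp_sub_one_le_two_mul hx2 hx2'
    linarith
  have hKc1 : ((1 + Fintype.card ι * (@basisConst ι _ (Matrix mm mm ℂ) Matrix.frobeniusNormedAddCommGroup Matrix.frobeniusNormedSpace e * (2 * Real.sqrt (Fintype.card mm)) * (Real.sqrt (Fintype.card mm) * (2 * ((c35 * (L : ℝ) ^ i.m * α₀) * ((((L ^ i.kk : ℕ) : ℝ))⁻¹)))))) ^ ((d + 2) * L ^ i.kk) - 1) ≤ 1 := hKc.trans hKr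
  have hKf1 : ((1 + Fintype.card ι * (@basisConst ι _ (Matrix mm mm ℂ) Matrix.frobeniusNormedAddCommGroup Matrix.frobeniusNormedSpace e * (2 * Real.sqrt (Fintype.card mm)) * (Real.sqrt (Fintype.card mm) * (2 * ((c35 * (L : ℝ) ^ i.m * α₀) * ((((L ^ i.r * L ^ i.kk : ℕ) : ℝ))⁻¹)))))) ^ ((d + 2) * (L ^ i.r * L ^ i.kk)) - 1) ≤ 1 := hKf.trans hKr
  have hKC0 : 0 ≤ ((1 + Fintype.card ι * (@basisConst ι _ (Matrix mm mm ℂ) Matrix.frobeniusNormedAddCommGroup Matrix.frobeniusNormedSpace e * (2 * Real.sqrt (Fintype.card mm)) * (Real.sqrt (Fintype.card mm) * (2 * ((c35 * (L : ℝ) ^ i.m * α₀) * ((((L ^ i.kk : ℕ) : ℝ))⁻¹)))))) ^ ((d + 2) * L ^ i.kk) - 1) := by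
    have := one_le_pow₀ (M₀ := ℝ) (a := 1 + Fintype.card ι * (@basisConst ι _ (Matrix mm mm ℂ) Matrix.frobeniusNormedAddCommGroup Matrix.frobeniusNormedSpace e * (2 * Real.sqrt (Fintype.card mm)) * (Real.sqrt (Fintype.card mm) * (2 * ((c35 * (L : ℝ) ^ i.m * α₀) * ((((L ^ i.kk : ℕ) : ℝ))⁻¹)))))) (by linarith [show (0:ℝ) ≤ Fintype.card ι * (@basisConst ι _ (Matrix mm mm ℂ) Matrix.frobeniusNormedAddCommGroup Matrix.frobeniusNormedSpace e * (2 * Real.sqrt (Fintype.card mm)) * (Real.sqrt (Fintype.card mm) * (2 * ((c35 * (L : ℝ) ^ i.m * α₀) * ((((L ^ i.kk : ℕ) : ℝ))⁻¹))))) by positivity]) (n := (d + 2) * L ^ i.kk); linarith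
  have hKF0 : 0 ≤ ((1 + Fintype.card ι * (@basisConst ι _ (Matrix mm mm ℂ) Matrix.frobeniusNormedAddCommGroup Matrix.frobeniusNormedSpace e * (2 * Real.sqrt (Fintype.card mm)) * (Real.sqrt (Fintype.card mm) * (2 * ((c35 * (L : ℝ) ^ i.m * α₀) * ((((L ^ i.r * L ^ i.kk : ℕ) : ℝ))⁻¹)))))) ^ ((d + 2) * (L ^ i.r * L ^ i.kk)) - 1) := by
    have := one_le_pow₀ (M₀ := ℝ) (a := 1 + Fintype.card ι * (@basisConst ι _ (Matrix mm mm ℂ) Matrix.frobeniusNormedAddCommGroup Matrix.frobeniusNormedSpace e * (2 * Real.sqrt (Fintype.card mm)) * (Real.sqrt (Fintype.card mm) * (2 * ((c35 * (L : ℝ) ^ i.m * α₀) * ((((L ^ i.r * L ^ i.kk : ℕ) : ℝ))⁻¹)))))) (by linarith [show (0:ℝ) ≤ Fintype.card ι * (@basisConst ι _ (Matrix mm mm ℂ) Matrix.frobeniusNormedAddCommGroup Matrix.frobeniusNormedSpace e * (2 * Real.sqrt (Fintype.card mm)) * (Real.sqrt (Fintype.card mm) * (2 * ((c35 * (L : ℝ)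 ^ i.m * α₀) * ((((L ^ i.r * L ^ i.kk : ℕ) : ℝ))⁻¹))))) by positivity]) (n := (d + 2) * (L ^ i.r * L ^ i.kk)); linarith
  have hKsum : ((1 + Fintype.card ι * (@basisConst ι _ (Matrix mm mm ℂ) Matrix.frobeniusNormedAddCommGroup Matrix.frobeniusNormedSpace e * (2 * Real.sqrt (Fintype.card mm)) * (Real.sqrt (Fintype.card mm) * (2 * ((c35 * (L : ℝ) ^ i.m * α₀) * ((((L ^ i.kk : ℕ) : ℝ))⁻¹)))))) ^ ((d + 2) * L ^ i.kk) - 1) + ((1 + Fintype.card ι * (@basisConst ι _ (Matrix mm mm ℂ) Matrix.frobeniusNormedAddCommGroup Matrix.frobeniusNormedSpace e * (2 * Real.sqrt (Fintype.card mm)) * (Real.sqrt (Fintype.card mm) * (2 * ((c35 * (L : ℝ) ^ i.m * α₀) * ((((L ^ i.r * L ^ i.kk : ℕ) : ℝ))⁻¹)))))) ^ ((d + 2) * (L ^ i.r * L ^ i.kk)) - 1) ≤ G * (c35 * (L : ℝ) ^ i.m * α₀) := by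
    show ((1 + Fintype.card ι * (@basisConst ι _ (Matrix mm mm ℂ) Matrix.frobeniusNormedAddCommGroup Matrix.frobeniusNormedSpace e * (2 * Real.sqrt (Fintype.card mm)) * (Real.sqrt (Fintype.card mm) * (2 * ((c35 * (L : ℝ) ^ i.m * α₀) * ((((L ^ i.kk : ℕ) : ℝ))⁻¹)))))) ^ ((d + 2) * L ^ i.kk) - 1) + ((1 + Fintype.card ι * (@basisConst ι _ (Matrix mm mm ℂ) Matrix.frobeniusNormedAddCommGroup Matrix.frobeniusNormedSpace e * (2 * Real.sqrt (Fintype.card mm)) * (Real.sqrt (Fintype.card mm) * (2 * ((c35 * (L : ℝ) ^ i.m * α₀) * ((((L ^ i.r * L ^ i.kk : ℕ) : ℝ))⁻¹)))))) ^ ((d + 2) * (L ^ i.r * L ^ i.kk)) - 1) ≤ 8 * ((d : ℝ) + 2) * Λ * (c35 * (L : ℝ) ^ i.m * α₀)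
    linarith
  -- the scale conditions of 191∕188 (with either `R₁`)
  have hscale : (14 * Real.exp 1 * (1 + Fintype.card (Fin (d + 1))) * basisConst e * ((1 + Fintype.card (Fin (d + 1))) * ((3 + 2 * ((d : ℝ) + 1)) * (c35 * (L : ℝ) ^ i.m * α₀)))) = σ * (c35 * (L : ℝ) ^ i.m * α₀) := by ring
  have hRθ : ∀ (R₀ R₁ : ℝ), 0 < R₀ → 0 < R₁ → (c35 * (L : ℝ) ^ i.m * α₀) ≤ R₀ / (σ * JJ + R₁ * G + 1) →
      (14 * Real.exp 1 * (1 + Fintype.card (Fin (d + 1))) * basisConst e * ((1 + Fintype.card (Fin (d + 1))) * ((3 + 2 * ((d : ℝ) + 1)) * (c35 * (L : ℝ) ^ i.m * α₀)))) * (1 + Fintype.card (Fin (d + 1) ⊕ Fin (d + 1))) + R₁ * (((1 + Fintype.card ι * (@basisConst ι _ (Matrix mm mm ℂ) Matrix.frobeniusNormedAddCommGroup Matrix.frobeniusNormedSpace e * (2 * Real.sqrt (Fintype.card mm)) * (Real.sqrt (Fintype.card mm) * (2 * ((c35 * (L : ℝ) ^ i.m * α₀) * ((((L ^ i.kk : ℕ)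 : ℝ))⁻¹)))))) ^ ((d + 2) * L ^ i.kk) - 1) + ((1 + Fintype.card ι * (@basisConst ι _ (Matrix mm mm ℂ) Matrix.frobeniusNormedAddCommGroup Matrix.frobeniusNormedSpace e * (2 * Real.sqrt (Fintype.card mm)) * (Real.sqrt (Fintype.card mm) * (2 * ((c35 * (L : ℝ) ^ i.m * α₀) * ((((L ^ i.r * L ^ i.kk : ℕ) : ℝ))⁻¹)))))) ^ ((d + 2) * (L ^ i.r * L ^ i.kk)) - 1)) ≤ R₀ := fun R₀ R₁ hR₀ hR₁ hr => by
    rw [hscale]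
    have hden : 0 < σ * JJ + R₁ * G + 1 := by positivity
    calc σ * (c35 * (L : ℝ) ^ i.m * α₀) * (1 + Fintype.card (Fin (d + 1) ⊕ Fin (d + 1))) + R₁ * (((1 + Fintype.card ι * (@basisConst ι _ (Matrix mm mm ℂ) Matrix.frobeniusNormedAddCommGroup Matrix.frobeniusNormedSpace e * (2 * Real.sqrt (Fintype.card mm)) * (Real.sqrt (Fintype.card mm) * (2 * ((c35 * (L : ℝ) ^ i.m * α₀) * ((((L ^ i.kk : ℕ) : ℝ))⁻¹)))))) ^ ((d + 2) * L ^ i.kk) - 1) + ((1 + Fintype.card ι * (@basisConst ι _ (Matrix mm mm ℂ) Matrix.frobeniusNormedAddCommGroup Matrix.frobeniusNormedSpace e * (2 * Real.sqrt (Fintype.card mm)) * (Real.sqrt (Fintype.card mm) * (2 * ((c35 * (L : ℝ) ^ i.m * α₀) * ((((L ^ i.r * L ^ i.kk : ℕ) : ℝ))⁻¹)))))) ^ ((d + 2) * (L ^ i.r * L ^ i.kk)) - 1)) ≤ σ * (c35 * (L : ℝ) ^ i.m * α₀) * JJ + R₁ * (G * (c35 * (L : ℝ) ^ i.m * α₀))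 := by
          show σ * (c35 * (L : ℝ) ^ i.m * α₀) * JJ + R₁ * (((1 + Fintype.card ι * (@basisConst ι _ (Matrix mm mm ℂ) Matrix.frobeniusNormedAddCommGroup Matrix.frobeniusNormedSpace e * (2 * Real.sqrt (Fintype.card mm)) * (Real.sqrt (Fintype.card mm) * (2 * ((c35 * (L : ℝ) ^ i.m * α₀) * ((((L ^ i.kk : ℕ) : ℝ))⁻¹)))))) ^ ((d + 2) * L ^ i.kk) - 1) + ((1 + Fintype.card ι * (@basisConst ι _ (Matrix mm mm ℂ) Matrix.frobeniusNormedAddCommGroup Matrix.frobeniusNormedSpace e * (2 * Real.sqrt (Fintype.card mm)) * (Real.sqrt (Fintype.card mm) * (2 * ((c35 * (L : ℝ) ^ i.m * α₀) * ((((L ^ i.r * L ^ i.kk : ℕ) : ℝ))⁻¹)))))) ^ ((d + 2) * (L ^ i.r * L ^ i.kk)) - 1)) ≤ σ * (c35 * (L : ℝ) ^ i.m * α₀) * JJ + R₁ * (G * (c35 * (L : ℝ) ^ i.m * α₀))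
          exact add_le_add le_rfl (mul_le_mul_of_nonneg_left hKsum hR₁.le)
      _ = (σ * JJ + R₁ * G) * (c35 * (L : ℝ) ^ i.m * α₀) := by ring
      _ ≤ (σ * JJ + R₁ * G) * (R₀ / (σ * JJ + R₁ * G + 1)) := mul_le_mul_of_nonneg_left hr (by positivity)
      _ = R₀ * ((σ * JJ + R₁ * G) / (σ * JJ + R₁ * G + 1)) := by ring
      _ ≤ R₀ * 1 := mul_le_mul_of_nonneg_left ((div_le_one hden).mpr (by linarith)) hR₀.le
      _ = R₀ := mul_one _
  have hθ' : ∀ (θ₀ R₁ : ℝ), 0 < θ₀ → 0 < R₁ → (c35 * (L : ℝ) ^ i.m * α₀) ≤ θ₀ / (R₁ * G + 1) → R₁ * (((1 + Fintype.card ι * (@basisConst ι _ (Matrix mm mm ℂ) Matrix.frobeniusNormedAddCommGroup Matrix.frobeniusNormedSpace e * (2 * Real.sqrt (Fintype.card mm)) * (Real.sqrt (Fintype.card mm) * (2 * ((c35 * (L : ℝ) ^ i.m * α₀) * ((((L ^ i.kk : ℕ) : ℝ))⁻¹)))))) ^ ((d + 2) * L ^ i.kk) - 1) + ((1 + Fintype.card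 ι * (@basisConst ι _ (Matrix mm mm ℂ) Matrix.frobeniusNormedAddCommGroup Matrix.frobeniusNormedSpace e * (2 * Real.sqrt (Fintype.card mm)) * (Real.sqrt (Fintype.card mm) * (2 * ((c35 * (L : ℝ) ^ i.m * α₀) * ((((L ^ i.r * L ^ i.kk : ℕ) : ℝ))⁻¹)))))) ^ ((d + 2) * (L ^ i.r * L ^ i.kk)) - 1)) ≤ θ₀ := fun θ₀ R₁ hθ₀ hR₁ hr => by
    have hden : 0 < R₁ * G + 1 := by positivity
    calc R₁ * (((1 + Fintype.card ι * (@basisConst ι _ (Matrix mm mm ℂ) Matrix.frobeniusNormedAddCommGroup Matrix.frobeniusNormedSpace e * (2 * Real.sqrt (Fintype.card mm)) * (Real.sqrt (Fintype.card mm) * (2 * ((c35 * (L : ℝ) ^ i.m * α₀) * ((((L ^ i.kk : ℕ) : ℝ))⁻¹)))))) ^ ((d + 2) * L ^ i.kk) - 1) + ((1 + Fintype.card ι * (@basisConst ι _ (Matrix mm mm ℂ) Matrix.frobeniusNormedAddCommGroup Matrix.frobeniusNormedSpace e * (2 * Real.sqrt (Fintype.card mm)) * (Real.sqrt (Fintype.card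 mm) * (2 * ((c35 * (L : ℝ) ^ i.m * α₀) * ((((L ^ i.r * L ^ i.kk : ℕ) : ℝ))⁻¹)))))) ^ ((d + 2) * (L ^ i.r * L ^ i.kk)) - 1)) ≤ R₁ * (G * (c35 * (L : ℝ) ^ i.m * α₀)) := mul_le_mul_of_nonneg_left hKsum hR₁.le
      _ = (R₁ * G) * (c35 * (L : ℝ) ^ i.m * α₀) := by ring
      _ ≤ (R₁ * G) * (θ₀ / (R₁ * G + 1)) := mul_le_mul_of_nonneg_left hr (by positivity)
      _ = θ₀ * ((R₁ * G) / (R₁ * G + 1)) := by ring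
      _ ≤ θ₀ * 1 := mul_le_mul_of_nonneg_left ((div_le_one hden).mpr (by linarith)) hθ₀.le
      _ = θ₀ := mul_one _
  have hRle_b := hRθ Rb R1b hRb hR1b (hrS.trans hsRb)
  have hθle_b := hθ' θb R1b hθb hR1b (hrS.trans hsθb)
  have hRle_c := hRθ Rc R1c hRc hR1c (hrS.trans hsRc)
  have hθle_c := hθ' θc R1c hθc hR1c (hrS.trans hsθc)
  -- the two landed letters at this index
  obtain ⟨hb, hb'⟩ := Hb i.m i.kk i.r i.one_le hwb e he A' hskew (c35 * (L : ℝ) ^ i.m * α₀) hrA0 hrA1 h1 h2' h3' hr2 hRle_b hθle_b hKc1 hKf1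
  have hc := Hc i.m i.kk i.r i.one_le hwc e he A' hskew (c35 * (L : ℝ) ^ i.m * α₀) hrA0 hrA1 h1 h2' h3' hr2 hRle_c hθle_c hKc1 hKf1
  -- the amplitudes: size `K_b(κ_e r_A + K_c + K_f) ≤ K_b(κ_e + G) r_A`; defect `K_c·[bracket] ≤ K_c(1 + C₁)(L^k)^{−1∕16}`
  have hsize : Kb * (basisConst e * (c35 * (L : ℝ) ^ i.m * α₀) + (((1 + Fintype.card ι * (@basisConst ι _ (Matrix mm mm ℂ) Matrix.frobeniusNormedAddCommGroup Matrix.frobeniusNormedSpace e * (2 * Real.sqrt (Fintype.card mm)) * (Real.sqrt (Fintype.card mm) * (2 * ((c35 * (L : ℝ) ^ i.m * α₀) * ((((L ^ i.kk : ℕ) : ℝ))⁻¹)))))) ^ ((d + 2) * L ^ i.kk) - 1) + ((1 + Fintype.card ι * (@basisConst ι _ (Matrix mm mm ℂ) Matrix.frobeniusNormedAddCommGroup Matrix.frobeniusNormedSpace e * (2 * Real.sqrt (Fintype.card mm)) * (Real.sqrt (Fintype.card mm) * (2 * ((c35 * (L : ℝ) ^ i.m * α₀) * ((((L ^ i.r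 * L ^ i.kk : ℕ) : ℝ))⁻¹)))))) ^ ((d + 2) * (L ^ i.r * L ^ i.kk)) - 1))) ≤ max (Kb * (basisConst e + G)) (Kc * (1 + C₁)) * (c35 * (L : ℝ) ^ i.m * α₀) := by
    calc Kb * (basisConst e * (c35 * (L : ℝ) ^ i.m * α₀) + (((1 + Fintype.card ι * (@basisConst ι _ (Matrix mm mm ℂ) Matrix.frobeniusNormedAddCommGroup Matrix.frobeniusNormedSpace e * (2 * Real.sqrt (Fintype.card mm)) * (Real.sqrt (Fintype.card mm) * (2 * ((c35 * (L : ℝ) ^ i.m * α₀) * ((((L ^ i.kk : ℕ) : ℝ))⁻¹)))))) ^ ((d + 2) * L ^ i.kk) - 1) + ((1 + Fintype.card ι * (@basisConst ι _ (Matrix mm mm ℂ) Matrix.frobeniusNormedAddCommGroup Matrix.frobeniusNormedSpace e * (2 * Real.sqrt (Fintype.card mm)) * (Real.sqrt (Fintype.card mm) * (2 * ((c35 * (L : ℝ) ^ i.m * α₀) * ((((L ^ i.r * L ^ i.kk : ℕ) : ℝ))⁻¹)))))) ^ ((d + 2) * (L ^ i.r * L ^ i.kk)) - 1))) ≤ Kb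 * (basisConst e * (c35 * (L : ℝ) ^ i.m * α₀) + G * (c35 * (L : ℝ) ^ i.m * α₀)) := mul_le_mul_of_nonneg_left (by linarith) hKb.le
      _ = (Kb * (basisConst e + G)) * (c35 * (L : ℝ) ^ i.m * α₀) := by ring
      _ ≤ max (Kb * (basisConst e + G)) (Kc * (1 + C₁)) * (c35 * (L : ℝ) ^ i.m * α₀) := mul_le_mul_of_nonneg_right (le_max_left _ _) hrA0
  have hbr : ((((L ^ i.kk : ℕ) : ℝ)) ^ (-(1 / 16 : ℝ)) + ((14 * Real.exp 1 * (1 + Fintype.card (Fin (d + 1))) * basisConst e * ((1 + Fintype.card (Fin (d + 1))) * ((3 + 2 * ((d : ℝ) + 1)) * (c35 * (L : ℝ) ^ i.m * α₀)))) * (1 + Fintype.card (Fin (d + 1) ⊕ Fin (d + 1))) * ((((L ^ i.kk : ℕ) : ℝ))⁻¹) + 2 * (R1c * (20 * ((((L ^ i.kk : ℕ) : ℝ))⁻¹) + 4 * Fintype.card ι * (@basisConst ι _ (Matrix mm mm ℂ) Matrix.frobeniusNormedAddCommGroup Matrix.frobeniusNormedSpace e * (2 * Real.sqrt (Fintype.card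 mm)) * (Real.sqrt (Fintype.card mm) * ((3 ^ (d + 1) * (72 * ((d : ℝ) + 1) ^ 2 + 9 * ((d : ℝ) + 1)) + (2 + 2 * Real.exp 1 + 2 * Real.exp 1 ^ 2 * ((d : ℝ) + 1))) * ((c35 * (L : ℝ) ^ i.m * α₀) * ((((L ^ i.kk : ℕ) : ℝ))⁻¹))))))))) ≤ (1 + C₁) * (((L ^ i.kk : ℕ) : ℝ)) ^ (-(1 / 16 : ℝ)) := by
    have hre : (14 * Real.exp 1 * (1 + Fintype.card (Fin (d + 1))) * basisConst e * ((1 + Fintype.card (Fin (d + 1))) * ((3 + 2 * ((d : ℝ) + 1)) * (c35 * (L : ℝ) ^ i.m * α₀)))) * (1 + Fintype.card (Fin (d + 1) ⊕ Fin (d + 1))) * ((((L ^ i.kk : ℕ) : ℝ))⁻¹) + 2 * (R1c * (20 * ((((L ^ i.kk : ℕ) : ℝ))⁻¹) + 4 * Fintype.card ι * (@basisConst ι _ (Matrix mm mm ℂ) Matrix.frobeniusNormedAddCommGroup Matrix.frobeniusNormedSpace e * (2 * Real.sqrt (Fintype.card mm)) * (Real.sqrt (Fintype.card mm) * ((3 ^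 (d + 1) * (72 * ((d : ℝ) + 1) ^ 2 + 9 * ((d : ℝ) + 1)) + (2 + 2 * Real.exp 1 + 2 * Real.exp 1 ^ 2 * ((d : ℝ) + 1))) * ((c35 * (L : ℝ) ^ i.m * α₀) * ((((L ^ i.kk : ℕ) : ℝ))⁻¹))))))) =
        (σ * (c35 * (L : ℝ) ^ i.m * α₀) * JJ + 2 * (R1c * (20 + 4 * (Λ * cΦ * (c35 * (L : ℝ) ^ i.m * α₀))))) * ((((L ^ i.kk : ℕ) : ℝ))⁻¹) := by
      show _ = (σ * (c35 * (L : ℝ) ^ i.m * α₀) * (1 + Fintype.card (Fin (d + 1) ⊕ Fin (d + 1))) + 2 * (R1c * (20 + 4 * ((Fintype.card ι * (@basisConst ι _ (Matrix mm mm ℂ) Matrix.frobeniusNormedAddCommGroup Matrix.frobeniusNormedSpace e * (2 * Real.sqrt (Fintype.card mm)) * Real.sqrt (Fintype.card mm))) * (3 ^ (d + 1) * (72 * ((d : ℝ) + 1) ^ 2 + 9 * ((d : ℝ) + 1)) + (2 + 2 * Real.exp 1 + 2 * Real.exp 1 ^ 2 * ((d : ℝ) + 1))) * (c35 * (L : ℝ)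 ^ i.m * α₀))))) * ((((L ^ i.kk : ℕ) : ℝ))⁻¹)
      ring
    have hC₁le : σ * (c35 * (L : ℝ) ^ i.m * α₀) * JJ + 2 * (R1c * (20 + 4 * (Λ * cΦ * (c35 * (L : ℝ) ^ i.m * α₀)))) ≤ C₁ := by
      show σ * (c35 * (L : ℝ) ^ i.m * α₀) * JJ + 2 * (R1c * (20 + 4 * (Λ * cΦ * (c35 * (L : ℝ) ^ i.m * α₀)))) ≤ σ * sX * JJ + 2 * (R1c * (20 + 4 * (Λ * cΦ * sX)))
      have h4 : Λ * cΦ * (c35 * (L : ℝ) ^ i.m * α₀) ≤ Λ * cΦ * sX := mul_le_mul_of_nonneg_left hrS (mul_nonneg hΛ0 hcΦ0)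
      have h5 : R1c * (20 + 4 * (Λ * cΦ * (c35 * (L : ℝ) ^ i.m * α₀))) ≤ R1c * (20 + 4 * (Λ * cΦ * sX)) := mul_le_mul_of_nonneg_left (by linarith) hR1c.le
      have h6 : σ * (c35 * (L : ℝ) ^ i.m * α₀) * JJ ≤ σ * sX * JJ := mul_le_mul_of_nonneg_right (mul_le_mul_of_nonneg_left hrS hσ0) hJJ0
      linarith
    have hco0 : 0 ≤ σ * (c35 * (L : ℝ) ^ i.m * α₀) * JJ + 2 * (R1c * (20 + 4 * (Λ * cΦ * (c35 * (L : ℝ) ^ i.m * α₀)))) := by positivity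
    have hB : (σ * (c35 * (L : ℝ) ^ i.m * α₀) * JJ + 2 * (R1c * (20 + 4 * (Λ * cΦ * (c35 * (L : ℝ) ^ i.m * α₀))))) * ((((L ^ i.kk : ℕ) : ℝ))⁻¹) ≤ C₁ * (((L ^ i.kk : ℕ) : ℝ)) ^ (-(1 / 16 : ℝ)) :=
      mul_le_mul hC₁le hηθ hη0 hC₁0
    rw [hre]
    linarith
  have hdef : Kc * ((((L ^ i.kk : ℕ) : ℝ)) ^ (-(1 / 16 : ℝ)) + ((14 * Real.exp 1 * (1 + Fintype.card (Fin (d + 1))) * basisConst e * ((1 + Fintype.card (Fin (d + 1))) * ((3 + 2 * ((d : ℝ) + 1)) * (c35 * (L : ℝ) ^ i.m * α₀)))) * (1 + Fintype.card (Fin (d + 1) ⊕ Fin (d + 1))) * ((((L ^ i.kk : ℕ) : ℝ))⁻¹) + 2 * (R1c * (20 * ((((L ^ i.kk : ℕ) : ℝ))⁻¹) + 4 * Fintype.card ι * (@basisConst ι _ (Matrix mm mm ℂ) Matrix.frobeniusNormedAddCommGroup Matrix.frobeniusNormedSpace e * (2 * Real.sqrt (Fintype.card mm)) * (Real.sqrt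 (Fintype.card mm) * ((3 ^ (d + 1) * (72 * ((d : ℝ) + 1) ^ 2 + 9 * ((d : ℝ) + 1)) + (2 + 2 * Real.exp 1 + 2 * Real.exp 1 ^ 2 * ((d : ℝ) + 1))) * ((c35 * (L : ℝ) ^ i.m * α₀) * ((((L ^ i.kk : ℕ) : ℝ))⁻¹))))))))) ≤ max (Kb * (basisConst e + G)) (Kc * (1 + C₁)) * (((L ^ i.kk : ℕ) : ℝ)) ^ (-(1 / 16 : ℝ)) := by
    calc Kc * ((((L ^ i.kk : ℕ) : ℝ)) ^ (-(1 / 16 : ℝ)) + ((14 * Real.exp 1 * (1 + Fintype.card (Fin (d + 1))) * basisConst e * ((1 + Fintype.card (Fin (d + 1))) * ((3 + 2 * ((d : ℝ) + 1)) * (c35 * (L : ℝ) ^ i.m * α₀)))) * (1 + Fintype.card (Fin (d + 1) ⊕ Fin (d + 1))) * ((((L ^ i.kk : ℕ) : ℝ))⁻¹) + 2 * (R1c * (20 * ((((L ^ i.kk : ℕ) : ℝ))⁻¹) + 4 * Fintype.card ι * (@basisConst ι _ (Matrix mm mm ℂ) Matrix.frobeniusNormedAddCommGroup Matrix.frobeniusNormedSpace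 e * (2 * Real.sqrt (Fintype.card mm)) * (Real.sqrt (Fintype.card mm) * ((3 ^ (d + 1) * (72 * ((d : ℝ) + 1) ^ 2 + 9 * ((d : ℝ) + 1)) + (2 + 2 * Real.exp 1 + 2 * Real.exp 1 ^ 2 * ((d : ℝ) + 1))) * ((c35 * (L : ℝ) ^ i.m * α₀) * ((((L ^ i.kk : ℕ) : ℝ))⁻¹))))))))) ≤ Kc * ((1 + C₁) * (((L ^ i.kk : ℕ) : ℝ)) ^ (-(1 / 16 : ℝ))) := mul_le_mul_of_nonneg_left hbr hKcpos.le
      _ = (Kc * (1 + C₁)) * (((L ^ i.kk : ℕ) : ℝ)) ^ (-(1 / 16 : ℝ)) := by ring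
      _ ≤ max (Kb * (basisConst e + G)) (Kc * (1 + C₁)) * (((L ^ i.kk : ℕ) : ℝ)) ^ (-(1 / 16 : ℝ)) := mul_le_mul_of_nonneg_right (le_max_right _ _) hθ0
  have hamp0 : 0 ≤ Kb * (basisConst e * (c35 * (L : ℝ) ^ i.m * α₀) + (((1 + Fintype.card ι * (@basisConst ι _ (Matrix mm mm ℂ) Matrix.frobeniusNormedAddCommGroup Matrix.frobeniusNormedSpace e * (2 * Real.sqrt (Fintype.card mm)) * (Real.sqrt (Fintype.card mm) * (2 * ((c35 * (L : ℝ) ^ i.m * α₀) * ((((L ^ i.kk : ℕ) : ℝ))⁻¹)))))) ^ ((d + 2) * L ^ i.kk) - 1) + ((1 + Fintype.card ι * (@basisConst ι _ (Matrix mm mm ℂ) Matrix.frobeniusNormedAddCommGroup Matrix.frobeniusNormedSpace e * (2 * Real.sqrt (Fintype.card mm)) * (Real.sqrt (Fintype.card mm) * (2 * ((c35 * (L : ℝ) ^ i.m * α₀) * ((((L ^ i.r * L ^ i.kk : ℕ) : ℝ))⁻¹)))))) ^ ((d + 2) * (L ^ i.r * L ^ i.kk)) - 1))) := by positivity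
  have hbr0 : 0 ≤ ((((L ^ i.kk : ℕ) : ℝ)) ^ (-(1 / 16 : ℝ)) + ((14 * Real.exp 1 * (1 + Fintype.card (Fin (d + 1))) * basisConst e * ((1 + Fintype.card (Fin (d + 1))) * ((3 + 2 * ((d : ℝ) + 1)) * (c35 * (L : ℝ) ^ i.m * α₀)))) * (1 + Fintype.card (Fin (d + 1) ⊕ Fin (d + 1))) * ((((L ^ i.kk : ℕ) : ℝ))⁻¹) + 2 * (R1c * (20 * ((((L ^ i.kk : ℕ) : ℝ))⁻¹) + 4 * Fintype.card ι * (@basisConst ι _ (Matrix mm mm ℂ) Matrix.frobeniusNormedAddCommGroup Matrix.frobeniusNormedSpace e * (2 * Real.sqrt (Fintype.card mm)) * (Real.sqrt (Fintype.card mm) * ((3 ^ (d + 1) * (72 * ((d : ℝ) + 1) ^ 2 + 9 * ((d : ℝ) + 1)) + (2 + 2 * Real.exp 1 + 2 * Real.exp 1 ^ 2 * ((d : ℝ) + 1))) * ((c35 * (L : ℝ) ^ i.m * α₀) * ((((L ^ i.kk : ℕ) : ℝ))⁻¹))))))))) := by positivity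
  refine ⟨?_, ?_, ?_⟩
  · exact (hasMaj_exp_mono hd hamp0 (min_le_left δb δc) hb).mono fun y y' => mul_le_mul_of_nonneg_right hsize (Real.exp_nonneg _)
  · exact (hasMaj_exp_mono hd hamp0 (min_le_left δb δc) hb').mono fun y y' => mul_le_mul_of_nonneg_right hsize (Real.exp_nonneg _)
  · exact (hasMaj_exp_mono hd (mul_nonneg hKcpos.le hbr0) (min_le_right δb δc) hc).mono fun y y' => mul_le_mul_of_nonneg_right hdef (Real.exp_nonneg _)

end Summit.QuantumFields.YangMills.BalabanUVNodes.N15.SiteLayerSf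

end
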